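/-
Copyright: the b2b-balaban T⁴-continuum CRUX team, row NE7b leaf lineage `t4-ne7b-formalise-leaf-06` (gen 159). Project licence.
-/
import Literature.MathematicalPhysics.QuantumFieldTheory.Balaban1983to89.B5Hk103ScalarZd

/-!
# THE ONE-SHOT SECTION IS REFLECTION-COVARIANT, AND AT SIDE 2 IT IS `1` ON THE HOME BLOCK: `H(σp, σ̄y) = H(p, y)` for every axis
# reflection `σ` of `ℤ^d` mapping blocks to blocks, hence `kerH 1 a p (blk 1 p) = 1` for every `p` (every `d`, every `a > 0`)
# (row NE7b, node U5c; the missing junction between leaf-01's kernel-weight row-sum number `ρ_∞(2) ≤ 2.594` (`BlockSectionRowSumValue`) and the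
# A-certificate socket `…OneShotChartACertificate.blockRMS_HB_le_of_rowCertificate`; [folklore] over `B5Hk103ScalarZd` + `B4Sect5Exhaustion` BY NAME)

Cell `pub-balaban`, sub-cell `t4`, spine estimate NE7b (`T4WeightBudget.RelWeightBound`; the cell's OWN estimate — NOT PRINTED in
[Bałaban 1983–89], NOT PROVED).  Crux-route work under `Spine/NE7b/` by leaf-06 (CRUX team (2), FREEZE (0) crux-prover clause).
NOTHING of Bałaban's is named as a Lean object, valued or asserted; no `T4Continuum/Support` leaf typed; no `def` (the reflections are characterised by
hypotheses `hσ` ∕ `hτ`, as `qb` is in `…OneStepCoarseCurlL2`); zero `sorry`.  Import: `Literature.….B5Hk103ScalarZd` ONLY.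

WHY.  OSCAC §2's per-row socket reads `|H(p, blk p) − 1| + Σ_{y ≠ blk p}|H(p,y)| ≤ ρ`; leaf-01's computational `BlockSectionRowSumValue.rowSum_value`
gives `Σ_y|H(p,y)| ≤ 2.594` (side 2, `d = 4`).  The bridge is `H(p, blk p) = 1` at side 2: the `2^d` sites of a side-2 block are ONE orbit of the axis
reflections fixing the block, `H` is covariant under them, and the block mean of `H(·,y)` over `B(y)` is `1` (`Q′H = 1`, `blockAvg_kerH`); so `ρ = 1.594`
and `K_mix(2) ≤ √(1 + 1.594²) < 1.882 < 2` modulo leaf-01's `native_decide` (that last junction is not typed here).  Covariance is the uniqueness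
argument `B4Sect5Exhaustion.eq_limInv_of_left_inverse` (the pattern of the OWNER's (54) `OneShotChartTorusRows.Kinv_translate`, here for reflections,
every `d`): the reflected kernels are bounded left inverses of the reflection-invariant `Δ^η + aQ′*Q′`, resp. `Q′G′Q′*`, on all of `ℤ^d`.

WHAT IS PROVED (all [folklore]; `σ` the fine reflection `p_μ ↦ side n·c + n − p_μ` in ONE axis `μ` (other coordinates fixed), `τ` the induced
coarse reflection `y_μ ↦ c − y_μ`; both characterised by hypotheses):
* §1 `sigma_sigma`, `tau_tau` (involutions), `blk_sigma` (`blk n (σ p) = τ (blk n p)`), `mem_B_tau_iff`, `sum_B_tau` (block sums transport),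
  `sigma_add_e_self ∕ sigma_sub_e_self ∕ sigma_add_e_ne ∕ sigma_sub_e_ne` (neighbours), `lapKer_sigma`, `sameBlk_sigma`, **`AX_sigma`**
  (`Δ^η + aQ′*Q′` is reflection-invariant).
* §2 **`Gk_sigma`** (`G′(σp, σq) = G′(p, q)`), `gq_sigma`, `kerQGQ_tau`, **`Kinv_tau`**, **`kerH_sigma`** (`H(σp, τy) = H(p, y)`).
* §3 **`kerH_one_home_eq_one`**: at side 2 (`n = 1`), `kerH 1 a p (blk 1 p) = 1` for every `p` and `a > 0`; `kerH_one_eq_of_mem_B` (constancy on the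
  home block).
* §4 **`rowCertificate_one_of_rowSum_le`** (the junction: `Σ′_y|H(p,y)| ≤ ϱ` ⇒ for every finite `T′ ∋ blk 1 p`,
  `|H(p, blk 1 p) − 1| + Σ_{y∈T′∖{blk 1 p}}|H(p,y)| ≤ ϱ − 1` — OSCAC's `hrow` with `ρ = ϱ − 1`).

HONEST: [folklore] symmetry bookkeeping; no number enters; `ℤ^d`, no torus; nothing of (A3) ∕ NC-NE7b-α.  BY-NAME EFFECT ON THE WALL: NONE.  NE7b NOT
PRINTED ∕ NOT PROVED; spine PROVED 0∕9; rung (B)+1 on a FINITE torus — NOT infinite volume, NOT the mass gap, NOT Clay.  HONEST DEPENDENCY: continuum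
YM on T⁴ ⇐ BetaPertH ∧ nine spine estimates (0∕9 proved); BetaPertH ⇐ (D1) ∧ (D4) ∧ CAP+tail; G-an2-4 gates asym, D1 and NE2∕3∕4.
-/

set_option autoImplicit false

namespace Summit.QuantumFields.BalabanUV.T4Continuum.NE7b.OneShotChartReflection

open Finset
open Literature.MathematicalPhysics.QuantumFieldTheory.Balaban1983to89
open B4Sect5Exhaustion (limInv eq_limInv_of_left_inverse)
open B6QGQLower276 (X B e blk loc side chart mem_B side_mul_blk_add_loc loc_nonneg loc_le lapDir lapKer sameBlk AX Aker kerQGQ KerQGQ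
  gammaQ gammaQ_pos c0 c0_pos hyp56Z_Aker)
open B6QGQDecay237 (cU cU_pos deltaU deltaU_pos cInv cInv_pos deltaInv deltaInv_pos hyp56Z_KerQGQ_unif)
open B5Hk103ScalarZd (Gk gq Kinv kerH toK abs_Gk_le abs_Kinv_le tsum_Gk_mul_AX tsum_Kinv_mul_kerQGQ blockAvg_kerH)

variable {d : ℕ}

/-! ## §1. One axis reflection of the two-scale lattice -/

section Reflection

variable (n : ℕ) (μ : Fin d) (c : ℤ)
  (σ : X d → X d) (hσ : ∀ p ν, σ p ν = if ν = μ then side n * c + n - p μ else p ν)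
  (τ : X d → X d) (hτ : ∀ y ν, τ y ν = if ν = μ then c - y μ else y ν)

include hσ in
/-- `σ` is an involution. [folklore] -/
theorem sigma_sigma (p : X d) : σ (σ p) = p := by
  funext ν; rw [hσ]; split_ifs with h
  · subst h; rw [hσ]; simp
  · rw [hσ]; simp [h]

include hτ in
/-- `τ` is an involution. [folklore] -/
theorem tau_tau (y : X d) : τ (τ y) = y := by
  funext ν; rw [hτ]; split_ifs with h
  · subst h; rw [hτ]; simp
  · rw [hτ]; simp [h]

include hσ in
/-- `σ` is injective. [folklore] -/
theorem sigma_injective : Function.Injective σ := fun p q h => by rw [← sigma_sigma n μ c σ hσ p, ← sigma_sigma n μ c σ hσ q, h]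

include hτ in
/-- `τ` is injective. [folklore] -/
theorem tau_injective : Function.Injective τ := fun y y' h => by rw [← tau_tau μ c τ hτ y, ← tau_tau μ c τ hτ y', h]

include hσ hτ in
/-- **`σ` MAPS BLOCKS TO BLOCKS**: `blk n (σ p) = τ (blk n p)` (block `y` goes to block `c − y` in axis `μ`). [folklore] -/
theorem blk_sigma (p : X d) : blk n (σ p) = τ (blk n p) := by
  funext ν
  rw [hτ]
  show σ p ν / side n = _
  rw [hσ]
  split_ifs with h
  · subst h
    have hs : (0 : ℤ) < side n := by unfold side; positivity
    have hdec := side_mul_blk_add_loc n p ν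
    have hl0 := loc_nonneg n p ν
    have hl1 : loc n p ν ≤ n := loc_le n p ν
    -- `side·c + n − p_ν = (n − loc) + (c − blk)·side` with `0 ≤ n − loc < side`
    have hre : side n * c + n - p ν = (↑n - loc n p ν) + (c - blk n p ν) * side n := by rw [← hdec]; ring
    rw [hre, Int.add_mul_ediv_right _ _ hs.ne', Int.ediv_eq_zero_of_lt (by omega) (by unfold side at *; omega), zero_add]
  · rfl

include hσ hτ in
/-- membership transport: `q ∈ B n (τ y) ↔ σ q ∈ B n y`. [folklore] -/
theorem mem_B_tau_iff (y q : X d) : q ∈ B n (τ y) ↔ σ q ∈ B n y := by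
  rw [mem_B, mem_B, blk_sigma n μ c σ hσ τ hτ]
  exact ⟨fun h => by rw [h, tau_tau μ c τ hτ], fun h => by rw [← h, tau_tau μ c τ hτ]⟩

include hσ hτ in
/-- **BLOCK SUMS TRANSPORT**: `Σ_{q ∈ B n (τ y)} f q = Σ_{q ∈ B n y} f (σ q)`. [folklore] -/
theorem sum_B_tau (y : X d) (f : X d → ℝ) : ∑ q ∈ B n (τ y), f q = ∑ q ∈ B n y, f (σ q) := by
  refine Finset.sum_equiv ((Function.Involutive.toPerm σ (sigma_sigma n μ c σ hσ))) (fun q => ?_) (fun q _ => ?_)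
  · rw [Function.Involutive.coe_toPerm]; exact mem_B_tau_iff n μ c σ hσ τ hτ y q
  · rw [Function.Involutive.coe_toPerm, sigma_sigma n μ c σ hσ]

include hσ in
/-- neighbours: `σ (p + e μ) = σ p − e μ`. [folklore] -/
theorem sigma_add_e_self (p : X d) : σ (p + e μ) = σ p - e μ := by
  funext ν; rw [hσ, Pi.sub_apply, hσ]; split_ifs with h
  · subst h; simp; ring
  · simp [Pi.add_apply, B6QGQLower276.e_apply_ne h]

include hσ in
/-- neighbours: `σ (p − e μ) = σ p + e μ`. [folklore] -/
theorem sigma_sub_e_self (p : X d) : σ (p - e μ) = σ p + e μ := by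
  funext ν; rw [hσ, Pi.add_apply, hσ]; split_ifs with h
  · subst h; simp; ring
  · simp [Pi.sub_apply, B6QGQLower276.e_apply_ne h]

include hσ in
/-- neighbours in the other axes: `σ (p + e ν) = σ p + e ν` for `ν ≠ μ`. [folklore] -/
theorem sigma_add_e_ne (p : X d) {ν : Fin d} (hν : ν ≠ μ) : σ (p + e ν) = σ p + e ν := by
  funext κ; simp only [Pi.add_apply, hσ]; split_ifs with h
  · subst h; rw [B6QGQLower276.e_apply_ne (Ne.symm hν)]; ring
  · rfl

include hσ in
/-- neighbours in the other axes: `σ (p − e ν) = σ p − e ν` for `ν ≠ μ`. [folklore] -/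
theorem sigma_sub_e_ne (p : X d) {ν : Fin d} (hν : ν ≠ μ) : σ (p - e ν) = σ p - e ν := by
  funext κ; simp only [Pi.sub_apply, hσ]; split_ifs with h
  · subst h; rw [B6QGQLower276.e_apply_ne (Ne.symm hν)]; ring
  · rfl

include hσ in
/-- the directional second difference is reflection-invariant. [folklore] -/
theorem lapDir_sigma (ν : Fin d) (p q : X d) : lapDir ν (σ p) (σ q) = lapDir ν p q := by
  have hinj := sigma_injective n μ c σ hσ
  unfold lapDir
  by_cases hν : ν = μ
  · subst hν
    have h1 : (σ q = σ p) ↔ (q = p) := hinj.eq_iff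
    have h2 : (σ q = σ p + e ν) ↔ (q = p - e ν) := by
      rw [← sigma_sub_e_self n ν c σ hσ p]; exact hinj.eq_iff
    have h3 : (σ q = σ p - e ν) ↔ (q = p + e ν) := by
      rw [← sigma_add_e_self n ν c σ hσ p]; exact hinj.eq_iff
    simp only [h1, h2, h3]
    ring
  · have h1 : (σ q = σ p) ↔ (q = p) := hinj.eq_iff
    have h2 : (σ q = σ p + e ν) ↔ (q = p + e ν) := by
      rw [← sigma_add_e_ne n μ c σ hσ p hν]; exact hinj.eq_iff
    have h3 : (σ q = σ p - e ν) ↔ (q = p - e ν) := by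
      rw [← sigma_sub_e_ne n μ c σ hσ p hν]; exact hinj.eq_iff
    simp only [h1, h2, h3]

include hσ in
/-- the lattice Laplacian kernel is reflection-invariant. [folklore] -/
theorem lapKer_sigma (p q : X d) : lapKer (σ p) (σ q) = lapKer p q := by
  unfold lapKer; exact Finset.sum_congr rfl fun ν _ => lapDir_sigma n μ c σ hσ ν p q

include hσ hτ in
/-- «same block» is reflection-invariant. [folklore] -/
theorem sameBlk_sigma (p q : X d) : sameBlk n (σ p) (σ q) = sameBlk n p q := by
  unfold sameBlk
  simp only [blk_sigma n μ c σ hσ τ hτ, (tau_injective μ c τ hτ).eq_iff]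

include hσ hτ in
/-- **THE SITE MATRIX `Δ^η + aQ′*Q′` IS REFLECTION-INVARIANT**: `AX n a (σ p) (σ q) = AX n a p q`. [folklore] -/
theorem AX_sigma (a : ℝ) (p q : X d) : AX n a (σ p) (σ q) = AX n a p q := by
  unfold AX; rw [lapKer_sigma n μ c σ hσ, sameBlk_sigma n μ c σ hσ τ hτ]

/-! ## §2. Covariance of `G′`, `Q′G′Q′*`, its inverse, and the section `H` -/

include hσ hτ in
/-- **`G′` IS REFLECTION-COVARIANT**: `G′(σp, σq) = G′(p, q)` — the reflected kernel is a bounded left inverse of the reflection-invariant site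
matrix on `ℤ^d`, hence equals `limInv` (`eq_limInv_of_left_inverse`). [folklore] -/
theorem Gk_sigma {a : ℝ} (ha : 0 < a) (p q : X d) : Gk n a (σ p) (σ q) = Gk n a p q := by
  have hγ : (0 : ℝ) < min 2 a := lt_min two_pos ha
  -- boundedness of the reflected kernel
  have hbd : ∀ p' q' : B4Sect5Exhaustion.K d 1, |Gk n a (σ p'.1) (σ q'.1)| ≤ 2 / min 2 a := fun p' q' => by
    refine (abs_Gk_le n ha _ _).trans (mul_le_of_le_one_right (by positivity) ?_)
    rw [Real.exp_le_one_iff, neg_nonpos]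
    have := deltaU_pos d ha
    positivity
  -- the reflected kernel is a left inverse of the site matrix
  have hinv : ∀ p' r' : B4Sect5Exhaustion.K d 1, p'.1 ∈ (Set.univ : Set (X d)) → r'.1 ∈ (Set.univ : Set (X d)) →
      ∑' q' : B4Sect5Exhaustion.K d 1, Gk n a (σ p'.1) (σ q'.1) * Aker n a q' r' = if p' = r' then 1 else 0 := by
    intro p' r' _ _
    have h1 : ∑' q' : B4Sect5Exhaustion.K d 1, Gk n a (σ p'.1) (σ q'.1) * Aker n a q' r'
        = ∑' w : X d, Gk n a (σ p'.1) (σ w) * AX n a w r'.1 := by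
      rw [← Equiv.tsum_eq (toK (d := d))]
      rfl
    have h2 : ∀ w : X d, Gk n a (σ p'.1) (σ w) * AX n a w r'.1 = Gk n a (σ p'.1) (σ w) * AX n a (σ w) (σ r'.1) := fun w => by
      rw [AX_sigma n μ c σ hσ τ hτ]
    have h3 : ∑' w : X d, Gk n a (σ p'.1) (σ w) * AX n a (σ w) (σ r'.1)
        = ∑' w' : X d, Gk n a (σ p'.1) w' * AX n a w' (σ r'.1) :=
      (Function.Involutive.toPerm σ (sigma_sigma n μ c σ hσ)).tsum_eq (fun w' => Gk n a (σ p'.1) w' * AX n a w' (σ r'.1))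
    rw [h1, tsum_congr h2, h3, tsum_Gk_mul_AX n ha]
    have hiff : σ p'.1 = σ r'.1 ↔ p' = r' := by
      rw [(sigma_injective n μ c σ hσ).eq_iff]
      exact ⟨fun h => Prod.ext h (Subsingleton.elim _ _), fun h => by rw [h]⟩
    simp only [hiff]
  exact eq_limInv_of_left_inverse hγ (c0_pos d n ha.ne') one_pos (hyp56Z_Aker (d := d) n a)
    (D := fun p' q' : B4Sect5Exhaustion.K d 1 => Gk n a (σ p'.1) (σ q'.1)) (M := 2 / min 2 a) hbd
    (fun p' q' h => absurd (Set.mem_univ _) h) hinv (p := (p, 0)) (s := (q, 0)) (Set.mem_univ _) (Set.mem_univ _)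

include hσ hτ in
/-- `G′Q′*` is covariant: `gq n a (σ p) (τ y) = gq n a p y`. [folklore] -/
theorem gq_sigma {a : ℝ} (ha : 0 < a) (p y : X d) : gq n a (σ p) (τ y) = gq n a p y := by
  unfold gq
  rw [sum_B_tau n μ c σ hσ τ hτ]
  exact Finset.sum_congr rfl fun q _ => Gk_sigma n μ c σ hσ τ hτ ha p q

include hσ hτ in
/-- `Q′G′Q′*` is covariant: `kerQGQ n a (τ y) (τ y') = kerQGQ n a y y'`. [folklore] -/
theorem kerQGQ_tau {a : ℝ} (ha : 0 < a) (y y' : X d) : kerQGQ n a (τ y) (τ y') = kerQGQ n a y y' := by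
  unfold kerQGQ
  congr 1
  rw [sum_B_tau n μ c σ hσ τ hτ]
  refine Finset.sum_congr rfl fun p _ => ?_
  rw [sum_B_tau n μ c σ hσ τ hτ]
  refine Finset.sum_congr rfl fun q _ => ?_
  exact Gk_sigma n μ c σ hσ τ hτ ha p q

include hσ hτ in
/-- **`(Q′G′Q′*)⁻¹` IS COVARIANT**: `Kinv n a (τ y) (τ y') = Kinv n a y y'` (the reflected kernel is a bounded left inverse of the
reflection-invariant `Q′G′Q′*` on `ℤ^d`; `eq_limInv_of_left_inverse`). [folklore] -/
theorem Kinv_tau {a : ℝ} (ha : 0 < a) (y y' : X d) : Kinv n a (τ y) (τ y') = Kinv n a y y' := by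
  have hγ := gammaQ_pos d ha
  have hbd : ∀ p' q' : B4Sect5Exhaustion.K d 1, |Kinv n a (τ p'.1) (τ q'.1)| ≤ cInv d a := fun p' q' => by
    refine (abs_Kinv_le n ha _ _).trans (mul_le_of_le_one_right (cInv_pos d ha).le ?_)
    rw [Real.exp_le_one_iff, neg_nonpos]
    have := deltaInv_pos d ha
    positivity
  have hinv : ∀ p' r' : B4Sect5Exhaustion.K d 1, p'.1 ∈ (Set.univ : Set (X d)) → r'.1 ∈ (Set.univ : Set (X d)) →
      ∑' q' : B4Sect5Exhaustion.K d 1, Kinv n a (τ p'.1) (τ q'.1) * KerQGQ n a q' r' = if p' = r' then 1 else 0 := by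
    intro p' r' _ _
    have h1 : ∑' q' : B4Sect5Exhaustion.K d 1, Kinv n a (τ p'.1) (τ q'.1) * KerQGQ n a q' r'
        = ∑' w : X d, Kinv n a (τ p'.1) (τ w) * kerQGQ n a w r'.1 := by
      rw [← Equiv.tsum_eq (toK (d := d))]
      rfl
    have h2 : ∀ w : X d, Kinv n a (τ p'.1) (τ w) * kerQGQ n a w r'.1 = Kinv n a (τ p'.1) (τ w) * kerQGQ n a (τ w) (τ r'.1) :=
      fun w => by rw [kerQGQ_tau n μ c σ hσ τ hτ ha]
    have h3 : ∑' w : X d, Kinv n a (τ p'.1) (τ w) * kerQGQ n a (τ w) (τ r'.1)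
        = ∑' w' : X d, Kinv n a (τ p'.1) w' * kerQGQ n a w' (τ r'.1) :=
      (Function.Involutive.toPerm τ (tau_tau μ c τ hτ)).tsum_eq (fun w' => Kinv n a (τ p'.1) w' * kerQGQ n a w' (τ r'.1))
    rw [h1, tsum_congr h2, h3, tsum_Kinv_mul_kerQGQ n ha]
    have hiff : τ p'.1 = τ r'.1 ↔ p' = r' := by
      rw [(tau_injective μ c τ hτ).eq_iff]
      exact ⟨fun h => Prod.ext h (Subsingleton.elim _ _), fun h => by rw [h]⟩
    simp only [hiff]
  exact eq_limInv_of_left_inverse hγ (cU_pos d ha) (deltaU_pos d ha) (hyp56Z_KerQGQ_unif (d := d) n ha)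
    (D := fun p' q' : B4Sect5Exhaustion.K d 1 => Kinv n a (τ p'.1) (τ q'.1)) (M := cInv d a) hbd
    (fun p' q' h => absurd (Set.mem_univ _) h) hinv (p := (y, 0)) (s := (y', 0)) (Set.mem_univ _) (Set.mem_univ _)

include hσ hτ in
/-- **THE ONE-SHOT SECTION IS REFLECTION-COVARIANT**: `kerH n a (σ p) (τ y) = kerH n a p y`. [folklore] -/
theorem kerH_sigma {a : ℝ} (ha : 0 < a) (p y : X d) : kerH n a (σ p) (τ y) = kerH n a p y := by
  unfold kerH
  rw [← (Function.Involutive.toPerm τ (tau_tau μ c τ hτ)).tsum_eq (fun w => gq n a (σ p) w * Kinv n a w (τ y))]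
  exact tsum_congr fun w => by
    simp only [Function.Involutive.coe_toPerm, gq_sigma n μ c σ hσ τ hτ ha, Kinv_tau n μ c σ hσ τ hτ ha]

end Reflection

/-! ## §3. Side 2: the section is `1` on the home block -/

/-- one reflection step on the home block at side 2: flipping coordinate `μ` inside the block `blk 1 p` does not change `H(·, blk 1 p)`.
[folklore] -/
theorem kerH_one_flip {a : ℝ} (ha : 0 < a) (p : X d) (μ : Fin d) :
    kerH 1 a (Function.update p μ (2 * (2 * blk 1 p μ) + 1 - p μ)) (blk 1 p) = kerH 1 a p (blk 1 p) := by
  set y := blk 1 p with hy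
  -- the reflection about block `y` in axis `μ`: `c = 2·y_μ`
  set σ : X d → X d := fun q ν => if ν = μ then side 1 * (2 * y μ) + 1 - q μ else q ν with hσ
  set τ : X d → X d := fun w ν => if ν = μ then 2 * y μ - w μ else w ν with hτ
  have hσ' : ∀ q ν, σ q ν = if ν = μ then side 1 * (2 * y μ) + (1 : ℕ) - q μ else q ν := fun q ν => by simp [hσ]
  have hτ' : ∀ w ν, τ w ν = if ν = μ then 2 * y μ - w μ else w ν := fun w ν => rfl
  have hτy : τ y = y := by
    funext ν; rw [hτ']
    split_ifs with h
    · subst h; ring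
    · rfl
  have hσp : σ p = Function.update p μ (2 * (2 * blk 1 p μ) + 1 - p μ) := by
    funext ν
    rw [hσ']
    by_cases h : ν = μ
    · subst h; simp [side]; ring
    · simp [h]
  have h := kerH_sigma 1 μ (2 * y μ) σ hσ' τ hτ' ha p y
  rw [hτy, hσp] at h
  exact h

/-- **CONSTANCY ON THE HOME BLOCK AT SIDE 2**: `kerH 1 a q (blk 1 p) = kerH 1 a p (blk 1 p)` for every `q` in the block of `p` (the `2^d` sites of a
side-2 block are one orbit of the axis flips). [folklore] -/
theorem kerH_one_eq_of_mem_B {a : ℝ} (ha : 0 < a) (p q : X d) (hq : q ∈ B 1 (blk 1 p)) :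
    kerH 1 a q (blk 1 p) = kerH 1 a p (blk 1 p) := by
  classical
  have hblk : blk 1 q = blk 1 p := mem_B.1 hq
  -- induction on the number of coordinates where `q` and `p` differ
  suffices key : ∀ (k : ℕ) (q : X d), blk 1 q = blk 1 p → (univ.filter fun ν => q ν ≠ p ν).card = k →
      kerH 1 a q (blk 1 p) = kerH 1 a p (blk 1 p) from key _ q hblk rfl
  intro k
  induction k with
  | zero =>
    intro q _ hk
    have hqp : q = p := by
      funext ν
      by_contra hne
      have : ν ∈ univ.filter fun ν => q ν ≠ p ν := Finset.mem_filter.2 ⟨Finset.mem_univ _, hne⟩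
      rw [Finset.card_eq_zero.1 hk] at this
      exact absurd this (Finset.notMem_empty _)
    rw [hqp]
  | succ k ih =>
    intro q hbq hk
    -- pick an axis where they differ and flip it inside the block
    obtain ⟨μ, hμ⟩ : (univ.filter fun ν => q ν ≠ p ν).Nonempty := by
      rw [← Finset.card_pos, hk]; exact Nat.succ_pos k
    have hμne : q μ ≠ p μ := (Finset.mem_filter.1 hμ).2
    -- flip axis `μ` inside the block: `q' := update q μ (4 y_μ + 1 − q_μ)`
    have hqμ : 2 * blk 1 p μ ≤ q μ ∧ q μ ≤ 2 * blk 1 p μ + 1 := by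
      have h1 := side_mul_blk_add_loc 1 q μ; have h2 := loc_nonneg 1 q μ; have h3 := loc_le 1 q μ
      rw [hbq] at h1; simp only [side] at h1; push_cast at h1 h3; omega
    have hpμ : 2 * blk 1 p μ ≤ p μ ∧ p μ ≤ 2 * blk 1 p μ + 1 := by
      have h1 := side_mul_blk_add_loc 1 p μ; have h2 := loc_nonneg 1 p μ; have h3 := loc_le 1 p μ
      simp only [side] at h1; push_cast at h1 h3; omega
    have hq'μ : Function.update q μ (2 * (2 * blk 1 p μ) + 1 - q μ) μ = p μ := by
      rw [Function.update_self]; omega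
    have hq'ν : ∀ ν, ν ≠ μ → Function.update q μ (2 * (2 * blk 1 p μ) + 1 - q μ) ν = q ν := fun ν hν => by
      rw [Function.update_of_ne hν]
    have hflip : kerH 1 a (Function.update q μ (2 * (2 * blk 1 p μ) + 1 - q μ)) (blk 1 p) = kerH 1 a q (blk 1 p) := by
      have h := kerH_one_flip ha q μ
      rwa [hbq] at h
    -- the flipped site is in the same block and differs from `p` in `k` coordinates
    have hbq' : blk 1 (Function.update q μ (2 * (2 * blk 1 p μ) + 1 - q μ)) = blk 1 p := by
      funext ν
      show Function.update q μ (2 * (2 * blk 1 p μ) + 1 - q μ) ν / side 1 = blk 1 p ν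
      by_cases hν : ν = μ
      · subst hν; rw [hq'μ]; rfl
      · rw [hq'ν ν hν]; exact congrFun hbq ν
    have hcard : (univ.filter fun ν => Function.update q μ (2 * (2 * blk 1 p μ) + 1 - q μ) ν ≠ p ν).card = k := by
      have hset : (univ.filter fun ν => Function.update q μ (2 * (2 * blk 1 p μ) + 1 - q μ) ν ≠ p ν)
          = (univ.filter fun ν => q ν ≠ p ν).erase μ := by
        ext ν
        simp only [Finset.mem_filter, Finset.mem_univ, true_and, Finset.mem_erase]
        by_cases hν : ν = μ
        · subst hν; rw [hq'μ]; simp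
        · rw [hq'ν ν hν]; simp [hν]
      rw [hset, Finset.card_erase_of_mem hμ, hk]; rfl
    rw [← hflip]
    exact ih _ hbq' hcard

/-- **THE SIDE-2 SECTION IS `1` ON THE HOME BLOCK**: `kerH 1 a p (blk 1 p) = 1` for every fine site `p`, every `d`, every `a > 0` — constancy on the
block (`kerH_one_eq_of_mem_B`) and the block mean `Q′H = 1` (`blockAvg_kerH`). [folklore] -/
theorem kerH_one_home_eq_one {a : ℝ} (ha : 0 < a) (p : X d) : kerH 1 a p (blk 1 p) = 1 := by
  have hN : (0 : ℝ) < (((1 : ℕ) : ℝ) + 1) ^ d := by positivity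
  have hp : p ∈ B 1 (blk 1 p) := mem_B.2 rfl
  have havg := blockAvg_kerH 1 ha (blk 1 p) (blk 1 p)
  rw [if_pos rfl] at havg
  have hconst : ∑ q ∈ B 1 (blk 1 p), kerH 1 a q (blk 1 p) = ∑ q ∈ B 1 (blk 1 p), kerH 1 a p (blk 1 p) :=
    Finset.sum_congr rfl fun q hq => kerH_one_eq_of_mem_B ha p q hq
  rw [hconst, Finset.sum_const, nsmul_eq_mul, B6QGQDecay237.card_B 1 (blk 1 p)] at havg
  -- `N⁻¹ · (N · H) = 1`
  rw [← mul_assoc, inv_mul_cancel₀ hN.ne', one_mul] at havg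
  exact havg

/-! ## §4. The junction: a total row-sum number is an A-certificate at side 2 -/

/-- **A TOTAL ROW-SUM NUMBER IS A PER-ROW A-CERTIFICATE AT SIDE 2**: if `Σ′_y |H(p,y)| ≤ ϱ` then, for every finite window `T′ ∋ blk 1 p`,
`|H(p, blk 1 p) − 1| + Σ_{y ∈ T′∖{blk 1 p}}|H(p,y)| ≤ ϱ − 1` — the home entry is EXACTLY `1` (§3), the rest of the row is at most `ϱ − 1`.  With
leaf-01's `BlockSectionRowSumValue.rowSum_value` (`ϱ = 2.594`, `d = 4`, computational) this is the hypothesis `hrow` of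
`OneShotChartACertificate.blockRMS_HB_le_of_rowCertificate` with `ρ = 1.594`, i.e. `K_mix(2) ≤ √(1 + 1.594²) < 1.882` (that junction is not typed here).
[folklore] -/
theorem rowCertificate_one_of_rowSum_le {a : ℝ} (ha : 0 < a) (p : X d) {ϱ : ℝ} (hϱ : ∑' y : X d, |kerH 1 a p y| ≤ ϱ)
    {T' : Finset (X d)} (hT : blk 1 p ∈ T') :
    |kerH 1 a p (blk 1 p) - 1| + ∑ y ∈ T'.erase (blk 1 p), |kerH 1 a p y| ≤ ϱ - 1 := by
  have hhome := kerH_one_home_eq_one ha p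
  rw [hhome, sub_self, abs_zero, zero_add]
  have hsplit := Finset.add_sum_erase T' (fun y => |kerH 1 a p y|) hT
  rw [hhome, abs_one] at hsplit
  -- the row is absolutely summable (entry bound against `summable_expX`; the OWNER's (46) `summable_abs_kerH_row` by content — inlined to keep
  -- the single Literature import)
  have hsum : Summable fun y : X d => |kerH 1 a p y| :=
    Summable.of_nonneg_of_le (fun y => abs_nonneg _) (fun y => B5Hk103ScalarZd.abs_kerH_le 1 ha p y)
      ((B5Hk103ScalarZd.summable_expX (B5Hk103ScalarZd.deltaH_pos d ha) (blk 1 p)).mul_left _)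
  have hfin : ∑ y ∈ T', |kerH 1 a p y| ≤ ∑' y : X d, |kerH 1 a p y| := hsum.sum_le_tsum T' fun y _ => abs_nonneg _
  linarith

end Summit.QuantumFields.BalabanUV.T4Continuum.NE7b.OneShotChartReflection
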